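/-
Copyright (c) 2026 the pub-hodgecm-mathlib formalisation cell (harness21).  Prover seat hodgecm-mathlib-K2E1-p08 (g6), Track B ∕ K2-LIT (build stream 29), h413 =
`stmt-HodgeConjecture-24833`, campaign «EIS-R7-BL-SPH-2∕3»; dealer K2E1-plan (g6) DEAL 2026-09-04T10:03:30Z (38b) «B–L BY-PRODUCTS» (rulings (33), (38)).
-/
import Summits.HodgeConjecture.HodgeConjecture.Theorems.K2E1SphericalEisensteinMeromorphicBallU2   -- ★ p859005 (K2E3-p12) P8 §2: the per-ball assembly (brings ★ G-a gluing, ★ G-c `exists_xSystem`, ★ SolP, ★ ℓ7, BL leaves)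
import HarnessLib

/-!
# h413 ∕ Track B «K2-LIT», «EIS-R7-BL-SPH-2∕3» — helper `K2E1BLMeromorphicFamilyByproductsU` (RANK-GENERIC): THE BY-PRODUCTS OF THE BERNSTEIN–LAPID CONSTRUCTION THAT THE `∃`-HEADS
# OF ★ P8 §1∕§2 DISCARD — the `g`-free vector solution `z ↦ (vX z, cc z) ∈ 𝓗_k(𝔛) × ℂ`, holomorphic off a closed discrete set, solving the `𝔛`-system there, equal to the Eisenstein data
# on the Godement set; the scalarisations `ĥ_i(z)⁻¹·Λ(vX z)`; normal-form gluing that remembers analyticity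

Cell `pub/hodgecm-mathlib`, crux H413 = `stmt-HodgeConjecture-24833`, route `HCCMUnconditional`; dealer K2E1-plan (g6) RULINGS (33) (the three by-products (E1) `g`-uniform pole set,
(E2) local `HX`-boundedness, (E3) the continued constant-term coefficient) and (38b) (payer = this seat; REPORT-FIRST census 10:2xZ: (E1)–(E3) are lost only by the `∃`-heads — ★ SolP
`K2E1MeromorphicSolutionPrinciple.exists_meromorphic_solution` :50 exports the open dense holomorphy set `U`, which ★ `exists_meromorphic_solution_eventually` :174 and ★ G-a
scalarisation drop).  THEOREMS ONLY (no `def`∕`instance`∕`notation`∕named-fact hypothesis∕`sorry`); lane `--kind proof --supports stmt-HodgeConjecture-24833 --as helper`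
(count-neutral; closes no socket; does NOT touch the closer — closer ED. 2 consumes these heads).

* §1 (generic Banach system) **`exists_solution_byproducts`**: under the hypotheses of ★ `exists_meromorphicOn_scalar_of_system'` minus the scalar data — `∃ v U`, `U ⊆ D` open, dense,
  CO-DISCRETE (`∀ z₀ ∈ D, ∀ᶠ s in 𝓝[≠] z₀, s ∈ U`, so `D ∖ U` is closed in `D` and locally finite), `v` holomorphic on `U`, meromorphic on `D`, `Sol(s) = {v s}` on `U`, and `v = e` on `U ∩ O`.
* §2 (generic gluing) `analyticAt_of_meromorphicNFAt_of_eventuallyEq`, **`exists_meromorphicNFOn_univ_of_balls`** (★ G-a :131 with the normal form AND the clause `G =ᶠ[𝓝[≠] z] F n` kept),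
  `exists_global_offSet` (a global closed discrete set from per-ball co-discrete sets).
* §3 (generic) **`exists_global_pole_set`** — the closer's «one call» for (E1) (dealer (45a)): the normal-form gluings of per-ball pieces with non-negative order on `U n` are ALL analytic off
  ONE closed discrete `P ⊆ {re ≤ 1}`.
* §4 (ED. 2, dealer (60)(1)) the `σ₀`-editions `exists_meromorphicNFOn_univ_of_eventually_balls_of_lt`, **`exists_global_pole_set_of_lt (σ₀) (hσ₀) (n₀) (hn₀ : σ₀ ≤ n₀ + 1)`**
  (half-plane `{σ₀ < re}`, data for `n ≥ n₀`, `P ⊆ {re ≤ σ₀}`; closer₃ ∕ capstone₃ at `σ₀ = 2`).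
* §3 (rank `N`, the `𝔛`-system of ★ P8 §2 with the SAME letters minus `g, Λ, hΛ, i₀, hĥ₀`) **`exists_xSystem_byproducts`**: `∃ U vX cc`, `U` open dense co-discrete in the ball, `vX`, `cc`
  holomorphic on `U`, the three equations `T_i(vX z) = ĥ_i(z)•vX z`, `cnstN (ι (vX z)) = φ₀•α₁ z + cc z•α₂ z`, `Q (vX z) = 0` and uniqueness on `U`, and `(vX, cc) = (eX, bX)` on
  `U ∩ {1 < re}` ((E2) = continuity of `vX` on `U`; (E3) = the `cnstN` clause).
* §4 (rank `N`) **`differentiableOn_scalarisation`**: for any `Λ ∈ 𝓗_k(𝔛)'`, `i`, `E` with `Λ (eX z) = ĥ_i(z)·E z` on the Godement part of the ball: `z ↦ ĥ_i(z)⁻¹·Λ(vX z)` is holomorphic on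
  `U ∩ {ĥ_i ≠ 0}` and equals `E` on `U ∩ {1 < re} ∩ {ĥ_i ≠ 0}` ((E1) per ball; with ★ `exists_bound_evalCLM_of_isCompact` the (ii′) majorant `‖E(z,x)‖ ≤ |ĥ_i z|⁻¹·C_K·‖vX z‖`).

HONEST LABEL.  Count-neutral helper of the BL-SPH template; closes no socket; HC_CM is proved only modulo the 7 printed citations (2 remaining named inputs: hLiu418 =
`stmt-HodgeConjecture-24832`, h413 = `stmt-HodgeConjecture-24833`) until rung 0 closes.

## References
* [BernsteinLapid2019] J. Bernstein, E. Lapid, *On the meromorphic continuation of Eisenstein series*, J. Amer. Math. Soc. 37 (2024) (arXiv:1911.02342), Thm 2.3, §2.1, §4 p. 10.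
* [ReedSimonI1980] M. Reed, B. Simon, *Methods of Modern Mathematical Physics I* (1980), Thm. VI.14 (analytic Fredholm theorem).
* [Iwaniec2002] H. Iwaniec, *Spectral Methods of Automorphic Forms* (2nd ed., 2002), §6.2, Thm 1.16.
-/

set_option autoImplicit false
-- the mandated namespace repeats `HodgeConjecture.HodgeConjecture`, as in every `Theorems/*.lean` of this sub-problem
set_option linter.dupNamespace false

noncomputable section

open MeasureTheory Filter Topology Set Submodule NumberField
open scoped NNReal ENNReal
open Literature.NumberTheory.Automorphic Literature.NumberTheory.Automorphic.UnitaryGroup AdelicGroupData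
open Summit.HodgeConjecture.HodgeConjecture.Cruxes.H413.K2E1BorelEisensteinU
open Summit.HodgeConjecture.HodgeConjecture.Cruxes.H413.K2E1BLBorelSpacesU2Defs
open Summit.HodgeConjecture.HodgeConjecture.Cruxes.H413.K2E1BLBorelOperatorsU2Defs
open Summit.HodgeConjecture.HodgeConjecture.Cruxes.H413.K2E1MeromorphicSolutionPrinciple (exists_meromorphic_solution)
open Summit.HodgeConjecture.HodgeConjecture.Cruxes.H413.K2E1BLMeromorphicGluing (exists_meromorphicNFOn_univ_of_exhaustion)
open Summit.HodgeConjecture.HodgeConjecture.Cruxes.H413.K2E1BLXSystemPackage (exists_xSystem xSystem_existsUnique_of)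
open Summit.HodgeConjecture.HodgeConjecture.Cruxes.H413.K2E1BLHeightPowerHolomorphicU2 (differentiableOn_HN_of_ae_eq_cpow_self differentiableOn_HN_of_ae_eq_cpow_one_sub)
open Summit.HodgeConjecture.HodgeConjecture.Cruxes.H413.K2E1SphericalHeckeEigenSectionU2 (differentiable_integral_mul_borelHeight_cpow)
open Summit.HodgeConjecture.HodgeConjecture.Cruxes.H413.K2E1SphericalEisensteinMeromorphicBallU2 (piN_comp_restrHN_comp_iota isCompactOperator_deltaShift_comp_one_sub_cnstN)

namespace Summit.HodgeConjecture.HodgeConjecture.Cruxes.H413.K2E1BLMeromorphicFamilyByproductsU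

/-! ## §1 The vector solution off a closed discrete set (generic Banach system) -/

/-- **THE `∃`-FREE CORE OF BERNSTEIN–LAPID'S Thm 2.3 AS THE CLOSER NEEDS IT.**  `D` open preconnected, a holomorphic Banach system `A z w = c z` locally of finite type, a known solution `e z`
on `D ∩ O` which is THE solution on some open non-empty `U₀ ⊆ D ∩ O`.  THEN there are `v : ℂ → 𝓥` and an open `U ⊆ D`, dense in `D` and CO-DISCRETE (`∀ z₀ ∈ D, ∀ᶠ s in 𝓝[≠] z₀,
s ∈ U` — so `D ∖ U` is closed in `D` and locally finite), with `v` holomorphic on `U`, meromorphic on `D`, `Sol(s) = {v s}` for `s ∈ U`, and `v = e` on `U ∩ O` (★ SolP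
`exists_meromorphic_solution` + its local form `f s ≠ 0 → s ∈ U`, `f ≠ 0` on a punctured neighbourhood). [cite: BernsteinLapid2019, Thm 2.3 and §4 p. 10] [cite: ReedSimonI1980, Thm. VI.14] -/
theorem exists_solution_byproducts {𝓥 𝓦 : Type*} [NormedAddCommGroup 𝓥] [NormedSpace ℂ 𝓥] [CompleteSpace 𝓥] [NormedAddCommGroup 𝓦] [NormedSpace ℂ 𝓦] [CompleteSpace 𝓦]
    {D : Set ℂ} (hD : IsOpen D) (hDc : IsPreconnected D) {A : ℂ → 𝓥 →L[ℂ] 𝓦} (hA : DifferentiableOn ℂ A D) {c : ℂ → 𝓦} (hc : DifferentiableOn ℂ c D)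
    (hfin : ∀ s₀ ∈ D, ∃ W ∈ 𝓝 s₀, ∃ n : ℕ, ∃ e : Fin n → ℂ → 𝓥, (∀ j, DifferentiableOn ℂ (e j) W) ∧ ∀ s ∈ W, ∀ v : 𝓥, A s v = c s → v ∈ span ℂ (Set.range fun j => e j s))
    {O : Set ℂ} {e : ℂ → 𝓥} (hsol : ∀ z ∈ D ∩ O, A z (e z) = c z)
    (hunq : ∃ U₀ : Set ℂ, IsOpen U₀ ∧ U₀.Nonempty ∧ U₀ ⊆ D ∩ O ∧ ∀ z ∈ U₀, ∀ w : 𝓥, A z w = c z → w = e z) :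
    ∃ (v : ℂ → 𝓥) (U : Set ℂ), IsOpen U ∧ U ⊆ D ∧ D ⊆ closure U ∧ (∀ z₀ ∈ D, ∀ᶠ s in 𝓝[≠] z₀, s ∈ U) ∧ DifferentiableOn ℂ v U ∧ MeromorphicOn v D ∧
      (∀ s ∈ U, ∀ w : 𝓥, A s w = c s ↔ w = v s) ∧ ∀ z ∈ U ∩ O, v z = e z := by
  obtain ⟨U₀, hU₀o, hU₀ne, hU₀D, hU₀unq⟩ := hunq
  have hunq' : ∃ U₀ : Set ℂ, IsOpen U₀ ∧ U₀.Nonempty ∧ U₀ ⊆ D ∧ ∀ s ∈ U₀, ∃! v : 𝓥, A s v = c s :=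
    ⟨U₀, hU₀o, hU₀ne, fun s hs => (hU₀D hs).1, fun s hs => ⟨e s, hsol s (hU₀D hs), fun w hw => hU₀unq s hs w hw⟩⟩
  obtain ⟨v, U, hUo, hUD, hcl, hvU, hsolU, hmer, hloc⟩ := exists_meromorphic_solution hD hDc hA hc hfin hunq'
  refine ⟨v, U, hUo, hUD, hcl, fun z₀ hz₀ => ?_, hvU, hmer, hsolU, fun z hz => ((hsolU z hz.1 (e z)).1 (hsol z ⟨hUD hz.1, hz.2⟩)).symm⟩
  obtain ⟨W, hW, f, u, -, -, hfne, hfU⟩ := hloc z₀ hz₀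
  filter_upwards [hfne, mem_nhdsWithin_of_mem_nhds hW] with s hs hsW
  exact (hfU s hsW hs).1

/-- A co-discrete open subset has a closed, locally finite complement: if `∀ z₀ ∈ D, ∀ᶠ s in 𝓝[≠] z₀, s ∈ U` then every `z₀ ∈ D` has a neighbourhood meeting `D ∖ U` in at most `{z₀}`.
[folklore] -/
theorem exists_nhds_inter_diff_subset_singleton {D U : Set ℂ} (hU : ∀ z₀ ∈ D, ∀ᶠ s in 𝓝[≠] z₀, s ∈ U) {z₀ : ℂ} (hz₀ : z₀ ∈ D) :
    ∃ W ∈ 𝓝 z₀, W ∩ (D \ U) ⊆ {z₀} := by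
  obtain ⟨W, hW, hWU⟩ := eventually_nhdsWithin_iff.1 (hU z₀ hz₀) |>.exists_mem
  refine ⟨W, hW, fun s hs => ?_⟩
  by_contra hne
  exact hs.2.2 (hWU s hs.1 hne)

/-! ## §2 Gluing in normal form, remembering analyticity (generic) -/

/-- A function in meromorphic normal form at `z` which is eventually (on a punctured neighbourhood) equal to a function analytic at `z` is itself analytic at `z` (orders agree and are
`≥ 0`). [folklore] -/
theorem analyticAt_of_meromorphicNFAt_of_eventuallyEq {𝓥 : Type*} [NormedAddCommGroup 𝓥] [NormedSpace ℂ 𝓥] {G F : ℂ → 𝓥} {z : ℂ} (hG : MeromorphicNFAt G z)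
    (hF : AnalyticAt ℂ F z) (h : G =ᶠ[𝓝[≠] z] F) : AnalyticAt ℂ G z := by
  rw [← hG.meromorphicOrderAt_nonneg_iff_analyticAt, meromorphicOrderAt_congr h]
  exact hF.meromorphicOrderAt_nonneg

/-- **GLUING OVER THE BALLS `ball 0 (n+2)`, IN NORMAL FORM** (★ G-a `exists_meromorphicOn_univ_of_balls` with BOTH extra conclusions kept: `G` is in meromorphic normal form on `ℂ`, and near
every point of `ball 0 (n+2)` it is eventually the piece `F n`). [cite: BernsteinLapid2019, §2.1 and §4 p. 10] [cite: Iwaniec2002, §6.2] -/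
theorem exists_meromorphicNFOn_univ_of_balls {𝓥 : Type*} [NormedAddCommGroup 𝓥] [NormedSpace ℂ 𝓥] [CompleteSpace 𝓥] {g : ℂ → 𝓥} (hg : DifferentiableOn ℂ g {z : ℂ | 1 < z.re})
    {F : ℕ → ℂ → 𝓥} (hF : ∀ n : ℕ, MeromorphicOn (F n) (Metric.ball (0 : ℂ) (n + 2)))
    (hFg : ∀ n : ℕ, ∀ z ∈ Metric.ball (0 : ℂ) (n + 2), 1 < z.re → F n z = g z) :
    ∃ G : ℂ → 𝓥, MeromorphicNFOn G univ ∧ (∀ z : ℂ, 1 < z.re → G z = g z) ∧ ∀ n : ℕ, ∀ z ∈ Metric.ball (0 : ℂ) (n + 2), G =ᶠ[𝓝[≠] z] F n := by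
  -- verbatim ★ G-a :131, minus the last `hG.meromorphicOn`
  have hO : IsOpen {z : ℂ | 1 < z.re} := isOpen_lt continuous_const Complex.continuous_re
  have hz₁ : ((3 / 2 : ℝ) : ℂ) ∈ Metric.ball (0 : ℂ) ((0 : ℕ) + 2) ∩ {z : ℂ | 1 < z.re} := by
    refine ⟨?_, ?_⟩
    · rw [Metric.mem_ball, dist_zero_right, Complex.norm_real, Real.norm_eq_abs, abs_of_pos (by norm_num)]
      norm_num
    · show (1 : ℝ) < ((3 / 2 : ℝ) : ℂ).re
      rw [Complex.ofReal_re]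
      norm_num
  have hcov : ∀ z : ℂ, ∃ n : ℕ, z ∈ Metric.ball (0 : ℂ) (n + 2) := fun z => by
    obtain ⟨n, hn⟩ := exists_nat_gt ‖z‖
    exact ⟨n, by rw [Metric.mem_ball, dist_zero_right]; linarith⟩
  have hmono : Monotone fun n : ℕ => Metric.ball (0 : ℂ) (n + 2) := fun n m hnm =>
    Metric.ball_subset_ball (by exact_mod_cast Nat.add_le_add_right hnm 2)
  obtain ⟨G, hG, hGg, hGF⟩ := exists_meromorphicNFOn_univ_of_exhaustion (D := fun n : ℕ => Metric.ball (0 : ℂ) (n + 2)) (fun n => Metric.isOpen_ball)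
    (fun n => (convex_ball (0 : ℂ) _).isPreconnected) hmono hcov hO hz₁ (hg.analyticOnNhd hO) hF (fun n z hz => hFg n z hz.1 hz.2)
  exact ⟨G, hG, fun z hz => hGg hz, hGF⟩

/-- **A GLOBAL CLOSED DISCRETE SET FROM PER-BALL CO-DISCRETE SETS**: if `U n ⊆ ball 0 (n+2)` is co-discrete in its ball for every `n`, then `P := {z | z ∉ U ⌈‖z‖⌉₊ ∨ z ∉ U (⌈‖z‖⌉₊ + 1)}`
(so `z ∉ P → z ∈ U ⌈‖z‖⌉₊`, with `z ∈ ball 0 (⌈‖z‖⌉₊ + 2)`) is CO-DISCRETE EVERYWHERE: `∀ z₀, ∀ᶠ s in 𝓝[≠] z₀, s ∉ P` — hence closed and locally finite. [folklore] -/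
theorem exists_global_offSet {U : ℕ → Set ℂ} (hU : ∀ n : ℕ, ∀ z₀ ∈ Metric.ball (0 : ℂ) (n + 2), ∀ᶠ s in 𝓝[≠] z₀, s ∈ U n) :
    ∃ P : Set ℂ, (∀ z₀ : ℂ, ∀ᶠ s in 𝓝[≠] z₀, s ∉ P) ∧ IsClosed P ∧ ∀ z, z ∉ P → z ∈ U ⌈‖z‖⌉₊ ∧ z ∈ U (⌈‖z‖⌉₊ + 1) := by
  -- co-discreteness at every `z₀`: nearby `⌈‖s‖⌉₊ ∈ {m, m + 1}`, `m = ⌈‖z₀‖⌉₊`, and `z₀` lies in the balls of indices `m`, `m + 1`, `m + 2`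
  have key : ∀ z₀ : ℂ, ∀ᶠ s in 𝓝[≠] z₀, s ∉ {z : ℂ | z ∉ U ⌈‖z‖⌉₊ ∨ z ∉ U (⌈‖z‖⌉₊ + 1)} := by
    intro z₀
    set m : ℕ := ⌈‖z₀‖⌉₊ with hm
    have hzm : ∀ j : ℕ, m ≤ j → z₀ ∈ Metric.ball (0 : ℂ) (j + 2) := fun j hj => by
      rw [Metric.mem_ball, dist_zero_right]
      have h1 : ‖z₀‖ ≤ m := Nat.le_ceil _
      have h2 : (m : ℝ) ≤ j := by exact_mod_cast hj
      linarith
    have hnear : ∀ᶠ s in 𝓝 z₀, ⌈‖s‖⌉₊ = m ∨ ⌈‖s‖⌉₊ = m + 1 := by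
      have hlt : ‖z₀‖ < (m : ℝ) + 1 := lt_of_le_of_lt (Nat.le_ceil _) (by linarith)
      have hgt : (m : ℝ) - 1 < ‖z₀‖ := by
        have := Nat.ceil_lt_add_one (norm_nonneg z₀)
        rw [← hm] at this; linarith
      have h1 : ∀ᶠ s in 𝓝 z₀, ‖s‖ < (m : ℝ) + 1 := (continuous_norm.tendsto z₀).eventually (gt_mem_nhds hlt)
      have h2 : ∀ᶠ s in 𝓝 z₀, (m : ℝ) - 1 < ‖s‖ := (continuous_norm.tendsto z₀).eventually (lt_mem_nhds hgt)
      filter_upwards [h1, h2] with s hs1 hs2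
      have hle : ⌈‖s‖⌉₊ ≤ m + 1 := Nat.ceil_le.2 (by push_cast; exact hs1.le)
      have hge : m ≤ ⌈‖s‖⌉₊ := by
        by_contra hlt'
        push Not at hlt'
        have h3 : (⌈‖s‖⌉₊ : ℝ) + 1 ≤ m := by exact_mod_cast Nat.lt_iff_add_one_le.1 hlt'
        linarith [Nat.le_ceil ‖s‖]
      omega
    have hU0 := hU m z₀ (hzm m le_rfl)
    have hU1 := hU (m + 1) z₀ (hzm (m + 1) (Nat.le_succ m))
    have hU2 := hU (m + 2) z₀ (hzm (m + 2) (by omega))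
    filter_upwards [hU0, hU1, hU2, mem_nhdsWithin_of_mem_nhds hnear] with s h0 h1 h2 hs
    simp only [not_or, not_not]
    rcases hs with hs | hs <;> rw [hs]
    · exact ⟨h0, h1⟩
    · exact ⟨h1, h2⟩
  refine ⟨{z | z ∉ U ⌈‖z‖⌉₊ ∨ z ∉ U (⌈‖z‖⌉₊ + 1)}, key, ?_, fun z hz => ?_⟩
  · -- closed: a point outside has a full neighbourhood outside
    rw [← isOpen_compl_iff, isOpen_iff_mem_nhds]
    intro z₀ hz₀
    have h1 : ∀ᶠ s in 𝓝 z₀, s ≠ z₀ → s ∉ {z : ℂ | z ∉ U ⌈‖z‖⌉₊ ∨ z ∉ U (⌈‖z‖⌉₊ + 1)} := eventually_nhdsWithin_iff.1 (key z₀)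
    filter_upwards [h1] with s hs
    by_cases hsz : s = z₀
    · rw [hsz]; exact hz₀
    · exact hs hsz
  · have hz' : ¬ (z ∉ U ⌈‖z‖⌉₊ ∨ z ∉ U (⌈‖z‖⌉₊ + 1)) := hz
    rw [not_or, not_not, not_not] at hz'
    exact hz'

/-! ## §3 The global pole set over the exhaustion by balls (generic; the closer's «one call» for (E1)) -/

/-- **THE GLOBAL `g`-UNIFORM POLE SET** (dealer (45a)).  Data: an index type `ι` (the points `g`), the Godement-range functions `g a` (holomorphic on `{1 < re}`), per-ball open
co-discrete sets `U n ⊆ ball 0 (n+2)` (the holomorphy sets of the vector solutions, ★ §1), and per-ball scalar pieces `F a n` meromorphic on the ball, `= g a` on its Godement part, with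
NON-NEGATIVE ORDER at every point of `U n` (★ §4 of the companion file).  THEN the normal-form gluings `G a` (meromorphic on `ℂ`, `= g a` on `{1 < re}`) are ALL analytic off ONE closed
discrete set `P ⊆ {re ≤ 1}`, outside of which moreover `z ∈ U ⌈‖z‖⌉₊ ∩ U (⌈‖z‖⌉₊ + 1)` unless `1 < re z`. [cite: BernsteinLapid2019, §2.1 and §4 p. 10] [cite: Iwaniec2002, §6.2] -/
theorem exists_global_pole_set {𝓥 : Type*} [NormedAddCommGroup 𝓥] [NormedSpace ℂ 𝓥] [CompleteSpace 𝓥] {ι : Type*}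
    {g : ι → ℂ → 𝓥} (hg : ∀ a, DifferentiableOn ℂ (g a) {z : ℂ | 1 < z.re})
    {U : ℕ → Set ℂ} (hU : ∀ n : ℕ, ∀ z₀ ∈ Metric.ball (0 : ℂ) (n + 2), ∀ᶠ s in 𝓝[≠] z₀, s ∈ U n)
    {F : ι → ℕ → ℂ → 𝓥} (hF : ∀ a (n : ℕ), MeromorphicOn (F a n) (Metric.ball (0 : ℂ) (n + 2)))
    (hFg : ∀ a (n : ℕ), ∀ z ∈ Metric.ball (0 : ℂ) (n + 2), 1 < z.re → F a n z = g a z)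
    (hord : ∀ a (n : ℕ), ∀ z ∈ Metric.ball (0 : ℂ) (n + 2), z ∈ U n → 0 ≤ meromorphicOrderAt (F a n) z) :
    ∃ (G : ι → ℂ → 𝓥) (P : Set ℂ), (∀ a, MeromorphicNFOn (G a) univ) ∧ (∀ a (z : ℂ), 1 < z.re → G a z = g a z) ∧
      (∀ a (n : ℕ), ∀ z ∈ Metric.ball (0 : ℂ) (n + 2), G a =ᶠ[𝓝[≠] z] F a n) ∧
      IsClosed P ∧ (∀ z₀ : ℂ, ∀ᶠ s in 𝓝[≠] z₀, s ∉ P) ∧ (∀ z ∈ P, z.re ≤ 1) ∧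
      (∀ z : ℂ, z ∉ P → 1 < z.re ∨ (z ∈ U ⌈‖z‖⌉₊ ∧ z ∈ U (⌈‖z‖⌉₊ + 1))) ∧
      (∀ a (z : ℂ), z ∉ P → AnalyticAt ℂ (G a) z) ∧ ∀ a, DifferentiableOn ℂ (G a) Pᶜ := by
  have hO : IsOpen {z : ℂ | 1 < z.re} := isOpen_lt continuous_const Complex.continuous_re
  choose G hG hGg hGF using fun a => exists_meromorphicNFOn_univ_of_balls (hg a) (hF a) (hFg a)
  obtain ⟨P₀, hP₀, hP₀c, hP₀U⟩ := exists_global_offSet hU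
  have hball : ∀ z : ℂ, z ∈ Metric.ball (0 : ℂ) ((⌈‖z‖⌉₊ : ℕ) + 2) := fun z => by
    rw [Metric.mem_ball, dist_zero_right]; linarith [Nat.le_ceil ‖z‖]
  have han : ∀ a (z : ℂ), z ∉ P₀ ∩ {z : ℂ | z.re ≤ 1} → AnalyticAt ℂ (G a) z := by
    intro a z hz
    by_cases hre : 1 < z.re
    · -- on the Godement half-plane `G a = g a`, holomorphic
      have h1 : AnalyticAt ℂ (g a) z := (hg a).analyticAt (hO.mem_nhds hre)
      refine h1.congr ?_
      filter_upwards [hO.mem_nhds hre] with s hs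
      exact (hGg a s hs).symm
    · have hz0 : z ∉ P₀ := fun h => hz ⟨h, le_of_not_gt hre⟩
      have hzU := (hP₀U z hz0).1
      rw [← (hG a (Set.mem_univ z)).meromorphicOrderAt_nonneg_iff_analyticAt, meromorphicOrderAt_congr (hGF a _ z (hball z))]
      exact hord a _ z (hball z) hzU
  refine ⟨G, P₀ ∩ {z : ℂ | z.re ≤ 1}, hG, hGg, hGF, hP₀c.inter (isClosed_le Complex.continuous_re continuous_const),
    fun z₀ => (hP₀ z₀).mono fun s hs h => hs h.1, fun z hz => hz.2, fun z hz => ?_, han, fun a z hz => (han a z hz).differentiableAt.differentiableWithinAt⟩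
  by_cases hre : 1 < z.re
  · exact Or.inl hre
  · exact Or.inr (hP₀U z fun h => hz ⟨h, le_of_not_gt hre⟩)

/-! ## §4 (ED. 2, dealer (60)(1)) The `σ₀`-editions: Godement half-plane `{σ₀ < re}`, pieces for `n ≥ n₀` only -/

/-- **GLUING OVER THE BALLS AGAINST `{σ₀ < Re z}`, IN NORMAL FORM, PIECES FOR `n ≥ n₀`** (`0 ≤ σ₀ ≤ n₀ + 1`; ★ K2E1-p10 `exists_meromorphicOn_univ_of_eventually_balls_of_lt` with the normal
form and the clause `G =ᶠ[𝓝[≠] z] F n` kept; base point `σ₀ + ½ ∈ ball 0 (n₀ + 2)`). [cite: BernsteinLapid2019, §2.1 and §4 p. 10] [cite: Iwaniec2002, §6.2] -/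
theorem exists_meromorphicNFOn_univ_of_eventually_balls_of_lt {𝓥 : Type*} [NormedAddCommGroup 𝓥] [NormedSpace ℂ 𝓥] [CompleteSpace 𝓥] {σ₀ : ℝ} (hσ₀ : 0 ≤ σ₀)
    (n₀ : ℕ) (hn₀ : σ₀ ≤ n₀ + 1) {g : ℂ → 𝓥} (hg : DifferentiableOn ℂ g {z : ℂ | σ₀ < z.re})
    {F : ℕ → ℂ → 𝓥} (hF : ∀ n : ℕ, n₀ ≤ n → MeromorphicOn (F n) (Metric.ball (0 : ℂ) (n + 2)))
    (hFg : ∀ n : ℕ, n₀ ≤ n → ∀ z ∈ Metric.ball (0 : ℂ) (n + 2), σ₀ < z.re → F n z = g z) :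
    ∃ G : ℂ → 𝓥, MeromorphicNFOn G univ ∧ (∀ z : ℂ, σ₀ < z.re → G z = g z) ∧ ∀ n : ℕ, n₀ ≤ n → ∀ z ∈ Metric.ball (0 : ℂ) (n + 2), G =ᶠ[𝓝[≠] z] F n := by
  have hO : IsOpen {z : ℂ | σ₀ < z.re} := isOpen_lt continuous_const Complex.continuous_re
  have hrad : ∀ m : ℕ, (((m + n₀ : ℕ) : ℝ) + 2) = (m : ℝ) + ((n₀ : ℝ) + 2) := fun m => by push_cast; ring
  have hz₁ : ((σ₀ + 1 / 2 : ℝ) : ℂ) ∈ Metric.ball (0 : ℂ) ((((0 : ℕ) + n₀ : ℕ) : ℝ) + 2) ∩ {z : ℂ | σ₀ < z.re} := by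
    refine ⟨?_, ?_⟩
    · rw [Metric.mem_ball, dist_zero_right, Complex.norm_real, Real.norm_eq_abs, abs_of_nonneg (by linarith), Nat.zero_add]
      linarith
    · show σ₀ < ((σ₀ + 1 / 2 : ℝ) : ℂ).re
      rw [Complex.ofReal_re]
      linarith
  have hcov : ∀ z : ℂ, ∃ m : ℕ, z ∈ Metric.ball (0 : ℂ) (((m + n₀ : ℕ) : ℝ) + 2) := fun z => by
    obtain ⟨m, hm⟩ := exists_nat_gt ‖z‖
    refine ⟨m, ?_⟩
    rw [Metric.mem_ball, dist_zero_right, hrad]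
    have : (0 : ℝ) ≤ n₀ := Nat.cast_nonneg n₀
    linarith
  have hmono : Monotone fun m : ℕ => Metric.ball (0 : ℂ) (((m + n₀ : ℕ) : ℝ) + 2) := fun m m' hmm' =>
    Metric.ball_subset_ball (by rw [hrad, hrad]; simpa using (Nat.cast_le (α := ℝ)).2 hmm')
  obtain ⟨G, hG, hGg, hGF⟩ := exists_meromorphicNFOn_univ_of_exhaustion (D := fun m : ℕ => Metric.ball (0 : ℂ) (((m + n₀ : ℕ) : ℝ) + 2)) (fun m => Metric.isOpen_ball)
    (fun m => (convex_ball (0 : ℂ) _).isPreconnected) hmono hcov hO hz₁ (hg.analyticOnNhd hO) (F := fun m => F (m + n₀))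
    (fun m => hF (m + n₀) (Nat.le_add_left _ _)) (fun m z hz => hFg (m + n₀) (Nat.le_add_left _ _) z hz.1 hz.2)
  refine ⟨G, hG, fun z hz => hGg hz, fun n hn z hz => ?_⟩
  obtain ⟨m, rfl⟩ := Nat.exists_eq_add_of_le' hn
  exact hGF m z hz

/-- **THE GLOBAL `g`-UNIFORM POLE SET, `σ₀`-EDITION** (dealer (60)(1); closer₃ ∕ capstone₃ at `σ₀ = 2`).  As `exists_global_pole_set`, with the Godement half-plane `{σ₀ < re}`
(`0 ≤ σ₀ ≤ n₀ + 1`) and per-ball data only for `n ≥ n₀`: the normal-form gluings `G a` are all analytic off ONE closed discrete `P ⊆ {re ≤ σ₀}`, outside of which, unless `σ₀ < re z`,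
`z ∈ U (max n₀ ⌈‖z‖⌉₊) ∩ U (max n₀ (⌈‖z‖⌉₊ + 1))` (and `z` lies in both balls). [cite: BernsteinLapid2019, §2.1 and §4 p. 10] [cite: Iwaniec2002, §6.2] -/
theorem exists_global_pole_set_of_lt {𝓥 : Type*} [NormedAddCommGroup 𝓥] [NormedSpace ℂ 𝓥] [CompleteSpace 𝓥] {ι : Type*} (σ₀ : ℝ) (hσ₀ : 0 ≤ σ₀) (n₀ : ℕ) (hn₀ : σ₀ ≤ n₀ + 1)
    {g : ι → ℂ → 𝓥} (hg : ∀ a, DifferentiableOn ℂ (g a) {z : ℂ | σ₀ < z.re})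
    {U : ℕ → Set ℂ} (hU : ∀ n : ℕ, n₀ ≤ n → ∀ z₀ ∈ Metric.ball (0 : ℂ) (n + 2), ∀ᶠ s in 𝓝[≠] z₀, s ∈ U n)
    {F : ι → ℕ → ℂ → 𝓥} (hF : ∀ a (n : ℕ), n₀ ≤ n → MeromorphicOn (F a n) (Metric.ball (0 : ℂ) (n + 2)))
    (hFg : ∀ a (n : ℕ), n₀ ≤ n → ∀ z ∈ Metric.ball (0 : ℂ) (n + 2), σ₀ < z.re → F a n z = g a z)
    (hord : ∀ a (n : ℕ), n₀ ≤ n → ∀ z ∈ Metric.ball (0 : ℂ) (n + 2), z ∈ U n → 0 ≤ meromorphicOrderAt (F a n) z) :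
    ∃ (G : ι → ℂ → 𝓥) (P : Set ℂ), (∀ a, MeromorphicNFOn (G a) univ) ∧ (∀ a (z : ℂ), σ₀ < z.re → G a z = g a z) ∧
      (∀ a (n : ℕ), n₀ ≤ n → ∀ z ∈ Metric.ball (0 : ℂ) (n + 2), G a =ᶠ[𝓝[≠] z] F a n) ∧
      IsClosed P ∧ (∀ z₀ : ℂ, ∀ᶠ s in 𝓝[≠] z₀, s ∉ P) ∧ (∀ z ∈ P, z.re ≤ σ₀) ∧
      (∀ z : ℂ, z ∉ P → σ₀ < z.re ∨ (z ∈ U (max n₀ ⌈‖z‖⌉₊) ∧ z ∈ U (max n₀ (⌈‖z‖⌉₊ + 1)))) ∧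
      (∀ a (z : ℂ), z ∉ P → AnalyticAt ℂ (G a) z) ∧ ∀ a, DifferentiableOn ℂ (G a) Pᶜ := by
  have hO : IsOpen {z : ℂ | σ₀ < z.re} := isOpen_lt continuous_const Complex.continuous_re
  choose G hG hGg hGF using fun a => exists_meromorphicNFOn_univ_of_eventually_balls_of_lt hσ₀ n₀ hn₀ (hg a) (hF a) (hFg a)
  -- the per-ball sets re-indexed by `n ↦ max n₀ n`
  have hU' : ∀ n : ℕ, ∀ z₀ ∈ Metric.ball (0 : ℂ) (n + 2), ∀ᶠ s in 𝓝[≠] z₀, s ∈ U (max n₀ n) := fun n z₀ hz₀ =>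
    hU (max n₀ n) (le_max_left _ _) z₀ (Metric.ball_subset_ball (by gcongr; exact le_max_right n₀ n) hz₀)
  obtain ⟨P₀, hP₀, hP₀c, hP₀U⟩ := exists_global_offSet hU'
  have hball : ∀ z : ℂ, z ∈ Metric.ball (0 : ℂ) (((max n₀ ⌈‖z‖⌉₊ : ℕ) : ℝ) + 2) := fun z => by
    rw [Metric.mem_ball, dist_zero_right]
    have h1 : (⌈‖z‖⌉₊ : ℝ) ≤ ((max n₀ ⌈‖z‖⌉₊ : ℕ) : ℝ) := by exact_mod_cast le_max_right n₀ ⌈‖z‖⌉₊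
    linarith [Nat.le_ceil ‖z‖]
  have han : ∀ a (z : ℂ), z ∉ P₀ ∩ {z : ℂ | z.re ≤ σ₀} → AnalyticAt ℂ (G a) z := by
    intro a z hz
    by_cases hre : σ₀ < z.re
    · have h1 : AnalyticAt ℂ (g a) z := (hg a).analyticAt (hO.mem_nhds hre)
      refine h1.congr ?_
      filter_upwards [hO.mem_nhds hre] with s hs
      exact (hGg a s hs).symm
    · have hz0 : z ∉ P₀ := fun h => hz ⟨h, le_of_not_gt hre⟩
      have hzU := (hP₀U z hz0).1
      rw [← (hG a (Set.mem_univ z)).meromorphicOrderAt_nonneg_iff_analyticAt, meromorphicOrderAt_congr (hGF a _ (le_max_left _ _) z (hball z))]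
      exact hord a _ (le_max_left _ _) z (hball z) hzU
  refine ⟨G, P₀ ∩ {z : ℂ | z.re ≤ σ₀}, hG, hGg, hGF, hP₀c.inter (isClosed_le Complex.continuous_re continuous_const),
    fun z₀ => (hP₀ z₀).mono fun s hs h => hs h.1, fun z hz => hz.2, fun z hz => ?_, han, fun a z hz => (han a z hz).differentiableAt.differentiableWithinAt⟩
  by_cases hre : σ₀ < z.re
  · exact Or.inl hre
  · exact Or.inr (hP₀U z fun h => hz ⟨h, le_of_not_gt hre⟩)

end Summit.HodgeConjecture.HodgeConjecture.Cruxes.H413.K2E1BLMeromorphicFamilyByproductsU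

end
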